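import Summits.HubbardSuperconductivity.HubbardSuperconductivity.Theorems.AnisotropyChordStiffnessFirstMoment
import Mathlib.LinearAlgebra.Lagrange

/-!
# Route `AnisotropyChord` / H0 rotor rung: STUB K3 of THEOREM TWIST-IR — REALITY / TIME REVERSAL of the
# filtered current kernel, `FilteredKernelSymmetric`, PROVED (work-order W6, theory seat memo ROTOR-THEORY-8 §120 (b′))

`F_{bb'} = Σᵢ g_Ω(ωᵢ) conj⟨vᵢ, j_bψ⟩⟨vᵢ, j_{b'}ψ⟩ = F_{b'b}`.  Proof (basis-free): interpolate `g_Ω(· − E₀)` on the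
(finite, real) spectrum by a polynomial `p` (Lagrange); then `F_{bb'} = ⟨j_bψ, p(H) j_{b'}ψ⟩` by completeness of
the eigenbasis applied to the CONJUGATED eigenvectors `conj vᵢ` (eigenvectors as well, `H` being a real matrix);
`H` real symmetric ⇒ `p(H)ᵀ = p(H)`; `j_bψ` real ⇒ the form is symmetric in `(b, b')`.

* `xxz_transpose_eq` (`Hᵀ = H`), `transpose_aeval`, `aeval_mulVec_of_eigen`, `star_eigenvector_mulVec`;
* `star_bondCurrent_mulVec_toC` — the bond-current image of a real amplitude is a real vector;
* `filteredKernel_eq_form` — `F_{bb'} = ⟨j_bψ, p(H) j_{b'}ψ⟩` for any polynomial matching `g_Ω` on the spectrum;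
* **`filteredKernelSymmetric_holds : ∀ Δ M, FilteredKernelSymmetric Δ M`**.
-/

set_option linter.dupNamespace false

noncomputable section

open Matrix Complex Finset Polynomial
open scoped ComplexConjugate
open Literature.MathematicalPhysics.QuantumLattice hiding torusPhase torusNorm
open Literature.Probability.LatticeModels
open Summit.HubbardSuperconductivity.HubbardSuperconductivity.Theorems.AnisotropyChord (xxz_entries_real_offdiag_nonpos)
open Summit.HubbardSuperconductivity.HubbardSuperconductivity.Theorems.AnisotropyChord.InsertionEntropy
  (IsPerronSectorGroundAmplitude)

namespace Summit.HubbardSuperconductivity.HubbardSuperconductivity.Theorems.AnisotropyChord.Stiffness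

/-! ## Matrix polynomials: transpose and eigenvectors -/

section MatrixPoly

variable {n : Type*} [Fintype n] [DecidableEq n]

/-- `(p(M))ᵀ = p(Mᵀ)`. [folklore] -/
theorem transpose_aeval (M : Matrix n n ℂ) (p : ℂ[X]) : (aeval M p)ᵀ = aeval Mᵀ p := by
  rw [aeval_eq_sum_range, aeval_eq_sum_range, transpose_sum]
  refine Finset.sum_congr rfl fun i _ => ?_
  rw [transpose_smul, transpose_pow]

/-- `Mv = μv ⇒ Mⁿ v = μⁿ v`. [folklore] -/
theorem pow_mulVec_of_eigen (M : Matrix n n ℂ) {v : n → ℂ} {μ : ℂ} (hv : M *ᵥ v = μ • v) (k : ℕ) :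
    (M ^ k) *ᵥ v = (μ ^ k) • v := by
  induction k with
  | zero => simp
  | succ k ih => rw [pow_succ, ← mulVec_mulVec, hv, mulVec_smul, ih, smul_smul, pow_succ']

/-- `Mv = μv ⇒ p(M) v = p(μ) v`. [folklore] -/
theorem aeval_mulVec_of_eigen (M : Matrix n n ℂ) (p : ℂ[X]) {v : n → ℂ} {μ : ℂ} (hv : M *ᵥ v = μ • v) :
    (aeval M p) *ᵥ v = (p.eval μ) • v := by
  rw [aeval_eq_sum_range, eval_eq_sum_range, Matrix.sum_mulVec, Finset.sum_smul]
  refine Finset.sum_congr rfl fun i _ => ?_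
  rw [Matrix.smul_mulVec, pow_mulVec_of_eigen M hv, smul_smul]

omit [DecidableEq n] in
/-- For a matrix with real entries, the conjugate of an eigenvector with real eigenvalue is an eigenvector. [folklore] -/
theorem star_eigenvector_mulVec (M : Matrix n n ℂ) (hM : ∀ i j, star (M i j) = M i j) {v : n → ℂ} {μ : ℝ}
    (hv : M *ᵥ v = (μ : ℂ) • v) : M *ᵥ star v = (μ : ℂ) • star v := by
  have hT : Mᴴ = Mᵀ := by
    ext i j
    rw [conjTranspose_apply, transpose_apply, hM]
  have h := congrArg star hv
  rw [star_mulVec, hT, vecMul_transpose, star_smul, Complex.star_def, Complex.conj_ofReal] at h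
  exact h

end MatrixPoly

/-! ## The XXZ torus: real symmetric Hamiltonian, real current vectors -/

variable {L : ℕ} [NeZero L]

/-- `H(Δ)` has real entries. [folklore] -/
theorem xxz_entry_real (Δ : ℝ) (σ τ : TensorIndex (TorusSite 2 L) 2) :
    star (hcbHamiltonian L Δ σ τ) = hcbHamiltonian L Δ σ τ :=
  (xxz_entries_real_offdiag_nonpos (torusGraph 2 L) Δ).1 σ τ

/-- `H(Δ)` is a real SYMMETRIC matrix: `Hᵀ = H`. [folklore] -/
theorem xxz_transpose_eq (Δ : ℝ) : (hcbHamiltonian L Δ)ᵀ = hcbHamiltonian L Δ := by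
  ext σ τ
  have hH := (hcbHamiltonian_isHermitian L Δ).eq
  have h := congrFun (congrFun hH σ) τ
  rw [conjTranspose_apply] at h
  rw [transpose_apply, ← h, xxz_entry_real]

/-- The bond-current image of a real amplitude is a real vector. [folklore] -/
theorem star_bondCurrent_mulVec_toC (x y : TorusSite 2 L) (a : TensorIndex (TorusSite 2 L) 2 → ℝ) :
    star (bondCurrent L x y *ᵥ toC L a) = bondCurrent L x y *ᵥ toC L a := by
  by_cases hxy : x = y
  · subst hxy
    funext σ
    rw [Pi.star_apply]
    unfold bondCurrent toC siteSpin
    simp only [Matrix.smul_mulVec, Pi.smul_apply, Matrix.sub_mulVec, Pi.sub_apply, ← Matrix.mulVec_mulVec,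
      LiebMattis.onSite_mulVec_apply, spinVec_one_zero_apply, spinVec_one_one_apply,
      Function.update_self, Function.update_idem, smul_eq_mul]
    have fin2 : ∀ t : Fin 2, t = 0 ∨ t = 1 := by decide
    rcases fin2 (σ x) with hx | hx <;> simp [hx, Complex.ext_iff] <;> ring
  · funext σ
    rw [Pi.star_apply, bondCurrent_mulVec_apply hxy]
    unfold toC
    split_ifs <;> simp

/-! ## The filtered kernel as a polynomial form -/

/-- **The filtered kernel as a bilinear form in a matrix polynomial:** if `p(λᵢ) = g_Ω(λᵢ − E₀)` on the spectrum,
then `F_{(x,j),(y,j')} = ⟨j_{x,j}ψ, p(H) j_{y,j'}ψ⟩`. [folklore] -/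
theorem filteredKernel_eq_form (Δ M : ℝ) (a : TensorIndex (TorusSite 2 L) 2 → ℝ) (Ω : ℝ)
    (p : ℂ[X]) (hp : ∀ i, p.eval (((hcbHamiltonian_isHermitian L Δ).eigenvalues i : ℝ) : ℂ)
      = (lorentzFilter Ω (excitation L Δ M i) : ℂ))
    (x : TorusSite 2 L) (j : Fin 2) (y : TorusSite 2 L) (j' : Fin 2) :
    filteredKernel L Δ M a Ω x j y j'
      = star (bondCurrent L x (x + Pi.single j 1) *ᵥ toC L a)
          ⬝ᵥ (aeval (hcbHamiltonian L Δ) p *ᵥ (bondCurrent L y (y + Pi.single j' 1) *ᵥ toC L a)) := by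
  unfold filteredKernel bondAmp
  set hH := hcbHamiltonian_isHermitian L Δ
  set w := bondCurrent L x (x + Pi.single j 1) *ᵥ toC L a with hw
  set w' := bondCurrent L y (y + Pi.single j' 1) *ᵥ toC L a with hw'
  set P := aeval (hcbHamiltonian L Δ) p with hP
  -- completeness: `⟨w, P w'⟩ = Σᵢ ⟨w, vᵢ⟩⟨vᵢ, P w'⟩`
  have hcomp := sum_dotProduct_mulVec_mul_dotProduct hH 1 w (P *ᵥ w')
  simp only [Matrix.one_mulVec] at hcomp
  rw [← hcomp]
  refine Finset.sum_congr rfl fun i _ => ?_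
  -- `⟨vᵢ, P w'⟩ = p(λᵢ) ⟨vᵢ, w'⟩` through the conjugated eigenvector `conj vᵢ` of the real symmetric `H`
  have hPt : Pᵀ = P := by rw [hP, transpose_aeval, xxz_transpose_eq]
  have heig : hcbHamiltonian L Δ *ᵥ ⇑(hH.eigenvectorBasis i) = ((hH.eigenvalues i : ℝ) : ℂ) • ⇑(hH.eigenvectorBasis i) := by
    rw [hH.mulVec_eigenvectorBasis i]; funext σ; simp [Pi.smul_apply]
  have hstar := star_eigenvector_mulVec (hcbHamiltonian L Δ) (xxz_entry_real Δ) heig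
  have h1 : star (⇑(hH.eigenvectorBasis i)) ⬝ᵥ (P *ᵥ w')
      = (lorentzFilter Ω (excitation L Δ M i) : ℂ) * (star (⇑(hH.eigenvectorBasis i)) ⬝ᵥ w') := by
    rw [dotProduct_mulVec, ← Matrix.mulVec_transpose, hPt, hP, aeval_mulVec_of_eigen _ p hstar, hp i,
      smul_dotProduct, smul_eq_mul]
  rw [h1, Matrix.star_dotProduct (⇑(hH.eigenvectorBasis i)) w]
  show _ * (star (star (star w ⬝ᵥ ⇑(hH.eigenvectorBasis i))) * _) = _
  rw [star_star]
  ring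

/-- **STUB K3 `FilteredKernelSymmetric` HOLDS** (work-order W6): the filtered current kernel of the XXZ torus in a
Perron sector state is symmetric over bond pairs (time reversal: `H`, `ψ`, `j_b` real). [folklore] -/
theorem filteredKernelSymmetric_holds (Δ : ℝ) (M : ℕ → ℝ) : FilteredKernelSymmetric Δ M := by
  intro L _ a _ Ω x j y j'
  classical
  set hH := hcbHamiltonian_isHermitian L Δ
  -- Lagrange interpolation of `g_Ω(· − E₀)` on the spectrum
  set S : Finset ℂ := Finset.univ.image fun i => ((hH.eigenvalues i : ℝ) : ℂ) with hS
  set p : ℂ[X] := Lagrange.interpolate S id fun z => (lorentzFilter Ω (z.re - lowestEnergyInSector 1 (hcbHamiltonian L Δ) (M L - 1)) : ℂ)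
    with hpdef
  have hp : ∀ i, p.eval (((hH.eigenvalues i : ℝ) : ℂ))
      = (lorentzFilter Ω (excitation L Δ (M L - 1) i) : ℂ) := by
    intro i
    have hi : ((hH.eigenvalues i : ℝ) : ℂ) ∈ S := Finset.mem_image.mpr ⟨i, Finset.mem_univ _, rfl⟩
    have h := Lagrange.eval_interpolate_at_node (v := id)
      (fun z => (lorentzFilter Ω (z.re - lowestEnergyInSector 1 (hcbHamiltonian L Δ) (M L - 1)) : ℂ))
      (Set.injOn_id _) hi
    rw [id] at h
    rw [hpdef, h, Complex.ofReal_re]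
    rfl
  rw [filteredKernel_eq_form Δ (M L - 1) a Ω p hp, filteredKernel_eq_form Δ (M L - 1) a Ω p hp]
  set P := aeval (hcbHamiltonian L Δ) p
  set w := bondCurrent L x (x + Pi.single j 1) *ᵥ toC L a
  set w' := bondCurrent L y (y + Pi.single j' 1) *ᵥ toC L a
  have hPt : Pᵀ = P := by
    show (aeval (hcbHamiltonian L Δ) p)ᵀ = aeval (hcbHamiltonian L Δ) p
    rw [transpose_aeval, xxz_transpose_eq]
  have hw : star w = w := star_bondCurrent_mulVec_toC _ _ a
  have hw' : star w' = w' := star_bondCurrent_mulVec_toC _ _ a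
  rw [hw, hw', dotProduct_mulVec, ← Matrix.mulVec_transpose, hPt, dotProduct_comm]

end Summit.HubbardSuperconductivity.HubbardSuperconductivity.Theorems.AnisotropyChord.Stiffness
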